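import Summits.NavierStokesRegularity.NavierStokesRegularity.Theorems.CorkscrewDynamoCorkscrewProfileStrictCoRotation
import Summits.NavierStokesRegularity.NavierStokesRegularity.Theorems.CorkscrewDynamoCorkscrewProfileCoRotationNecessity
import Literature.Analysis.FluidPDE.TaoEnstrophyLocalisationProofs
import Literature.Analysis.FluidPDE.SverakLandauConformalCalc
import HarnessLib

/-!
# Route CorkscrewDynamo · crux `CorkscrewProfile` (stmt-NavierStokesRegularity-11282) — tools for the Gaussian angular-momentum identity (stub W3)

Helper file of stub `gaussian_angularMomentum_eq_lambTorque` of line `registered` (skeleton v14, lead c6,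
wave 3), proved in `CorkscrewDynamoCorkscrewProfileGaussianAngularMomentum.lean`. For a rotated Leray
profile `U : ℝ³ → ℝ³` write `J = rotGen = e₃ × ·`, `ω = curl U`, `ω₃ = (curl U ·) 2`, `U₃ = (U ·) 2`,
`b = U + ½y − αJy` and `F = ω₃ b − ∇ω₃ − U₃ ω` (the vertical-vorticity flux). This file records:

* pointwise linear algebra on `ℝ³`: `⟪Jy, u × w⟫ = u₃ ⟪y, w⟫ − w₃ ⟪y, u⟫`, `⟪y, J u⟫ = −⟪Jy, u⟫`,
  `⟪y, Jy⟫ = 0`, and the radial pairing `⟪y, F⟫ = ω₃ ⟪y, U⟫ + ½ ω₃ ‖y‖² − ⟪y, ∇ω₃⟫ − U₃ ⟪y, ω⟫`;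
* elementary calculus: `div (J U) = tr (J DU) = −ω₃` and `div (θ y) = 3θ + ⟪y, ∇θ⟫`
  (`Sverak2011.divergence_id_three`); the flux identity `div F = ½ ω₃` and `F ∈ C¹` are the tree's
  `divergence_verticalVorticityFlux`, `contDiff_verticalVorticityFlux`
  (`CorkscrewDynamoCorkscrewProfileStrictCoRotation.lean`);
* a small calculus of polynomial bounds `‖f(y)‖ ≤ C (1 + ‖y‖)ᴺ` (products, sums) and the polynomial
  bounds of `ω`, `ω₃`, `∇ω₃` and `F` in terms of those of `U`, `DU`, `D curl U`, plus the regularity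
  package of a smooth field.

All statements are folklore (coordinates, Leibniz rule, triangle inequality).
-/

noncomputable section

open MeasureTheory InnerProductSpace
open Literature.Analysis.FluidPDE
open scoped RealInnerProductSpace Laplacian

namespace Summit.NavierStokesRegularity.NavierStokesRegularity.Theorems.CorkscrewProfile.Birth

set_option linter.dupNamespace false

/-! ### Pointwise linear algebra on `ℝ³` -/

/-- **The Lamb torque about the axis in coordinates**: `⟪Jy, u × w⟫ = u₃ ⟪y, w⟫ − w₃ ⟪y, u⟫` for
`J = rotGen = e₃ × ·` (expand both sides). [folklore] -/
theorem inner_rotGen_cross_eq_sub (y u w : EuclideanSpace ℝ (Fin 3)) :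
    ⟪rotGen y, cross u w⟫ = u 2 * ⟪y, w⟫ - w 2 * ⟪y, u⟫ := by
  simp only [cross, PiLp.inner_apply, RCLike.inner_apply, conj_trivial, Fin.sum_univ_three,
    cross_apply, Matrix.cons_val_zero, Matrix.cons_val_one, Matrix.cons_val_two,
    Matrix.tail_cons, rotGen_apply_zero, rotGen_apply_one, rotGen_apply_two]
  ring

/-- `⟪y, J u⟫ = −⟪J y, u⟫` (`J = rotGen` is skew). [folklore] -/
theorem inner_rotGen_right_eq_neg_inner_rotGen_left (y u : EuclideanSpace ℝ (Fin 3)) :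
    ⟪y, rotGen u⟫ = -⟪rotGen y, u⟫ := by
  rw [real_inner_comm, inner_rotGen_left, inner_rotGen_left]
  ring

/-- `⟪y, J y⟫ = 0` (`J = rotGen` is skew). [folklore] -/
theorem inner_rotGen_right_self_eq_zero (y : EuclideanSpace ℝ (Fin 3)) : ⟪y, rotGen y⟫ = 0 := by
  rw [real_inner_comm, inner_rotGen_self]

/-- **The radial pairing of the vertical-vorticity flux**: for `F = ω₃ b − g − U₃ ω` with
`b = U + ½y − αJy`, `⟪y, F⟫ = ω₃ ⟪y, U⟫ + ½ ω₃ ‖y‖² − ⟪y, g⟫ − U₃ ⟪y, ω⟫` (`⟪y, Jy⟫ = 0`,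
`⟪y, y⟫ = ‖y‖²`). [folklore] -/
theorem inner_self_verticalVorticityFlux_eq (α ω₃ U₃ : ℝ) (y Uy g ω : EuclideanSpace ℝ (Fin 3)) :
    ⟪y, ω₃ • (Uy + (1 / 2 : ℝ) • y - α • rotGen y) - g - U₃ • ω⟫ =
      ω₃ * ⟪y, Uy⟫ + (1 / 2 : ℝ) * (ω₃ * ‖y‖ ^ 2) - ⟪y, g⟫ - U₃ * ⟪y, ω⟫ := by
  rw [inner_sub_right, inner_sub_right, real_inner_smul_right, real_inner_smul_right, inner_sub_right,
    inner_add_right, real_inner_smul_right, real_inner_smul_right, real_inner_self_eq_norm_sq,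
    inner_rotGen_right_self_eq_zero]
  ring

/-! ### Elementary calculus on `ℝ³` -/

/-- **`div (J ∘ U) = −ω₃`**: the divergence of `y ↦ J U(y)` is `tr (J ∘ DU(y)) = −(curl U)₃(y)`
(`traceCLM_smul_rotGenL_comp_fderiv`). [folklore] -/
theorem divergence_rotGen_comp_eq_neg_curl_two
    {U : EuclideanSpace ℝ (Fin 3) → EuclideanSpace ℝ (Fin 3)} (hUd : Differentiable ℝ U)
    (y : EuclideanSpace ℝ (Fin 3)) :
    VectorCalculus.divergence (fun z => rotGen (U z)) y = -(curl U y 2) := by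
  have h : HasFDerivAt (fun z => rotGen (U z)) (rotGenL.comp (fderiv ℝ U y)) y :=
    rotGenL.hasFDerivAt.comp y (hUd y).hasFDerivAt
  have h1 : rotGenL.comp (fderiv ℝ U y) = ((1 : ℝ) • rotGenL).comp (fderiv ℝ U y) := by rw [one_smul]
  rw [divergence_eq_traceCLM, h.fderiv, h1, traceCLM_smul_rotGenL_comp_fderiv]
  ring

/-- **`div (θ y) = 3 θ + ⟪y, ∇θ⟫`** on `ℝ³` (Leibniz rule `div (θ u) = θ div u + ⟪u, ∇θ⟫` with `u = id`,
`div id = 3`, `Sverak2011.divergence_id_three`). [folklore] -/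
theorem divergence_smul_self_eq {θ : EuclideanSpace ℝ (Fin 3) → ℝ} {y : EuclideanSpace ℝ (Fin 3)}
    (hθ : DifferentiableAt ℝ θ y) :
    VectorCalculus.divergence (fun z => θ z • z) y = 3 * θ y + ⟪y, gradient θ y⟫ := by
  rw [divergence_smul_apply (u := fun z => z) hθ differentiableAt_id, Sverak2011.divergence_id_three]
  ring

/-! ### Polynomial bounds and Gaussian integrability -/

/-- Product rule for polynomial bounds: `p ≤ a b`, `0 ≤ a ≤ C_a Rᵐ`, `0 ≤ b ≤ C_b Rⁿ` give
`p ≤ C_a C_b R^{m+n}`. [folklore] -/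
theorem le_mul_mul_pow_add {p a b Ca Cb R : ℝ} {m n : ℕ} (hp : p ≤ a * b) (ha0 : 0 ≤ a)
    (hb0 : 0 ≤ b) (ha : a ≤ Ca * R ^ m) (hb : b ≤ Cb * R ^ n) :
    p ≤ Ca * Cb * R ^ (m + n) := by
  calc p ≤ a * b := hp
    _ ≤ (Ca * R ^ m) * (Cb * R ^ n) := mul_le_mul ha hb hb0 (ha0.trans ha)
    _ = Ca * Cb * R ^ (m + n) := by rw [pow_add]; ring

/-- Sum rule for polynomial bounds (`1 ≤ R`): `‖u‖ ≤ C_a Rᵐ`, `‖v‖ ≤ C_b Rⁿ` give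
`‖u‖ + ‖v‖ ≤ (C_a + C_b) R^{m+n}`. [folklore] -/
theorem norm_add_norm_le_add_mul_pow {V : Type*} [SeminormedAddCommGroup V] {u v : V}
    {Ca Cb R : ℝ} {m n : ℕ} (hR : 1 ≤ R) (ha : ‖u‖ ≤ Ca * R ^ m) (hb : ‖v‖ ≤ Cb * R ^ n) :
    ‖u‖ + ‖v‖ ≤ (Ca + Cb) * R ^ (m + n) := by
  have hR0 : 0 < R := by linarith
  have hCa : 0 ≤ Ca := nonneg_of_mul_nonneg_left ((norm_nonneg u).trans ha) (pow_pos hR0 m)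
  have hCb : 0 ≤ Cb := nonneg_of_mul_nonneg_left ((norm_nonneg v).trans hb) (pow_pos hR0 n)
  have hm : R ^ m ≤ R ^ (m + n) := pow_le_pow_right₀ hR (Nat.le_add_right m n)
  have hn : R ^ n ≤ R ^ (m + n) := pow_le_pow_right₀ hR (Nat.le_add_left n m)
  calc ‖u‖ + ‖v‖ ≤ Ca * R ^ m + Cb * R ^ n := add_le_add ha hb
    _ ≤ Ca * R ^ (m + n) + Cb * R ^ (m + n) := by gcongr
    _ = (Ca + Cb) * R ^ (m + n) := by ring

/-- `‖y‖ ≤ 1 · (1 + ‖y‖)¹`. [folklore] -/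
theorem norm_le_one_mul_one_add_norm_pow_one {V : Type*} [SeminormedAddCommGroup V] (y : V) :
    ‖y‖ ≤ 1 * (1 + ‖y‖) ^ 1 := by
  rw [one_mul, pow_one]
  exact le_add_of_nonneg_left zero_le_one

/-- `‖c‖ ≤ ‖c‖ · (1 + ‖y‖)⁰` (constants are polynomially bounded). [folklore] -/
theorem norm_const_le_mul_one_add_norm_pow_zero {V : Type*} [SeminormedAddCommGroup V] (c : ℝ)
    (y : V) : ‖c‖ ≤ ‖c‖ * (1 + ‖y‖) ^ 0 := by
  rw [pow_zero, mul_one]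

/-- `‖Jy‖ ≤ 1 · (1 + ‖y‖)¹` (`‖Jy‖ ≤ ‖y‖`, `PineauVicol2026.norm_rotGen_le`). [folklore] -/
theorem norm_rotGen_le_one_mul_one_add_norm_pow_one (y : EuclideanSpace ℝ (Fin 3)) :
    ‖rotGen y‖ ≤ 1 * (1 + ‖y‖) ^ 1 :=
  (PineauVicol2026.norm_rotGen_le y).trans (norm_le_one_mul_one_add_norm_pow_one y)

/-- Polynomial bound of the vorticity from that of the velocity gradient:
`‖curl U(y)‖ ≤ ‖curlCLM‖ K (1 + ‖y‖)ᴺ` (`norm_curl_le`). [folklore] -/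
theorem norm_curl_le_poly {K : ℝ} {N : ℕ} {U : EuclideanSpace ℝ (Fin 3) → EuclideanSpace ℝ (Fin 3)}
    (hD1 : ∀ y : EuclideanSpace ℝ (Fin 3), ‖fderiv ℝ U y‖ ≤ K * (1 + ‖y‖) ^ N)
    (y : EuclideanSpace ℝ (Fin 3)) : ‖curl U y‖ ≤ ‖curlCLM‖ * K * (1 + ‖y‖) ^ N :=
  calc ‖curl U y‖ ≤ ‖curlCLM‖ * ‖fderiv ℝ U y‖ := norm_curl_le U y
    _ ≤ ‖curlCLM‖ * (K * (1 + ‖y‖) ^ N) := mul_le_mul_of_nonneg_left (hD1 y) (norm_nonneg curlCLM)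
    _ = ‖curlCLM‖ * K * (1 + ‖y‖) ^ N := by ring

/-- Polynomial bound of the vertical vorticity: `|ω₃(y)| ≤ ‖curlCLM‖ K (1 + ‖y‖)ᴺ`. [folklore] -/
theorem norm_curl_two_le_poly {K : ℝ} {N : ℕ}
    {U : EuclideanSpace ℝ (Fin 3) → EuclideanSpace ℝ (Fin 3)}
    (hD1 : ∀ y : EuclideanSpace ℝ (Fin 3), ‖fderiv ℝ U y‖ ≤ K * (1 + ‖y‖) ^ N)
    (y : EuclideanSpace ℝ (Fin 3)) : ‖curl U y 2‖ ≤ ‖curlCLM‖ * K * (1 + ‖y‖) ^ N :=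
  (PiLp.norm_apply_le (curl U y) 2).trans (norm_curl_le_poly hD1 y)

/-- Polynomial bound of `∇ω₃`: `‖∇ω₃(y)‖ = ‖Dω₃(y)‖ ≤ ‖Dω(y)‖ ≤ K (1 + ‖y‖)ᴺ`. [folklore] -/
theorem norm_gradient_curl_two_le_poly {K : ℝ} {N : ℕ}
    {U : EuclideanSpace ℝ (Fin 3) → EuclideanSpace ℝ (Fin 3)} (hωd : Differentiable ℝ (curl U))
    (hD2 : ∀ y : EuclideanSpace ℝ (Fin 3), ‖fderiv ℝ (curl U) y‖ ≤ K * (1 + ‖y‖) ^ N)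
    (y : EuclideanSpace ℝ (Fin 3)) : ‖gradient (fun w => curl U w 2) y‖ ≤ K * (1 + ‖y‖) ^ N := by
  rw [Literature.Analysis.FluidPDE.norm_gradient_eq_norm_fderiv]
  exact (norm_fderiv_apply_two_le_norm_fderiv (hωd y)).trans (hD2 y)

/-- Regularity package of a smooth field: `curl U ∈ C²`, `ω₃ ∈ C¹`, and `U`, `curl U`, `ω₃`, `U₃`,
`∇ω₃` are continuous. [folklore] -/
theorem smooth_regularity_package {U : EuclideanSpace ℝ (Fin 3) → EuclideanSpace ℝ (Fin 3)}
    (hU : ContDiff ℝ (⊤ : ℕ∞) U) :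
    ContDiff ℝ 2 (curl U) ∧ ContDiff ℝ 1 (fun w => curl U w 2) ∧ Continuous U ∧
      Continuous (curl U) ∧ Continuous (fun w => curl U w 2) ∧ Continuous (fun w => U w 2) ∧
      Continuous (gradient (fun w => curl U w 2)) := by
  have hU3 : ContDiff ℝ 3 U := hU.of_le (WithTop.coe_le_coe.2 le_top)
  have hω2 : ContDiff ℝ 2 (curl U) := contDiff_curl (n := 2) (by exact_mod_cast hU3)
  have hω₃2 : ContDiff ℝ 2 (fun w => curl U w 2) :=
    (EuclideanSpace.proj (2 : Fin 3) : EuclideanSpace ℝ (Fin 3) →L[ℝ] ℝ).contDiff.comp hω2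
  have hU₃ : Continuous (fun w => U w 2) :=
    (EuclideanSpace.proj (2 : Fin 3) : EuclideanSpace ℝ (Fin 3) →L[ℝ] ℝ).continuous.comp hU.continuous
  have hg : Continuous (gradient (fun w => curl U w 2)) :=
    (InnerProductSpace.toDual ℝ (EuclideanSpace ℝ (Fin 3))).symm.continuous.comp
      (hω₃2.continuous_fderiv two_ne_zero)
  exact ⟨hω2, hω₃2.of_le (by norm_num), hU.continuous, hω2.continuous, hω₃2.continuous, hU₃, hg⟩

/-- The vertical-vorticity flux `F = ω₃ b − ∇ω₃ − U₃ ω` is polynomially bounded when `U`, `DU`,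
`D curl U` are. [folklore] -/
theorem norm_verticalVorticityFlux_le_poly {α K : ℝ} {N : ℕ}
    {U : EuclideanSpace ℝ (Fin 3) → EuclideanSpace ℝ (Fin 3)} (hU : ContDiff ℝ (⊤ : ℕ∞) U)
    (hUb : ∀ y : EuclideanSpace ℝ (Fin 3), ‖U y‖ ≤ K * (1 + ‖y‖) ^ N)
    (hD1 : ∀ y : EuclideanSpace ℝ (Fin 3), ‖fderiv ℝ U y‖ ≤ K * (1 + ‖y‖) ^ N)
    (hD2 : ∀ y : EuclideanSpace ℝ (Fin 3), ‖fderiv ℝ (curl U) y‖ ≤ K * (1 + ‖y‖) ^ N) :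
    ∃ (C : ℝ) (M : ℕ), ∀ y : EuclideanSpace ℝ (Fin 3),
      ‖(curl U y 2) • (U y + (1 / 2 : ℝ) • y - α • rotGen y) - gradient (fun w => curl U w 2) y
          - (U y 2) • curl U y‖ ≤ C * (1 + ‖y‖) ^ M := by
  obtain ⟨hω2, -, -, -, -, -, -⟩ := smooth_regularity_package hU
  have hωd : Differentiable ℝ (curl U) := hω2.differentiable two_ne_zero
  have hR : ∀ y : EuclideanSpace ℝ (Fin 3), (1 : ℝ) ≤ 1 + ‖y‖ := fun y =>
    le_add_of_nonneg_right (norm_nonneg _)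
  -- the pieces of the drift `b = U + ½y − αJy`
  have h2 : ∀ y : EuclideanSpace ℝ (Fin 3),
      ‖(1 / 2 : ℝ) • y‖ ≤ ‖(1 / 2 : ℝ)‖ * 1 * (1 + ‖y‖) ^ (0 + 1) := fun y =>
    le_mul_mul_pow_add (norm_smul_le _ _) (norm_nonneg _) (norm_nonneg _)
      (norm_const_le_mul_one_add_norm_pow_zero (1 / 2 : ℝ) y) (norm_le_one_mul_one_add_norm_pow_one y)
  have h3 : ∀ y : EuclideanSpace ℝ (Fin 3), ‖α • rotGen y‖ ≤ ‖α‖ * 1 * (1 + ‖y‖) ^ (0 + 1) :=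
    fun y => le_mul_mul_pow_add (norm_smul_le _ _) (norm_nonneg _) (norm_nonneg _)
      (norm_const_le_mul_one_add_norm_pow_zero α y) (norm_rotGen_le_one_mul_one_add_norm_pow_one y)
  have hb : ∀ y : EuclideanSpace ℝ (Fin 3), ‖U y + (1 / 2 : ℝ) • y - α • rotGen y‖ ≤
      (K + ‖(1 / 2 : ℝ)‖ * 1 + ‖α‖ * 1) * (1 + ‖y‖) ^ (N + (0 + 1) + (0 + 1)) := fun y =>
    (norm_sub_le _ _).trans (norm_add_norm_le_add_mul_pow (hR y)
      ((norm_add_le _ _).trans (norm_add_norm_le_add_mul_pow (hR y) (hUb y) (h2 y))) (h3 y))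
  -- the transport term `ω₃ b`, the diffusion term `∇ω₃`, the stretching term `U₃ ω`
  have hA : ∀ y : EuclideanSpace ℝ (Fin 3), ‖(curl U y 2) • (U y + (1 / 2 : ℝ) • y - α • rotGen y)‖ ≤
      ‖curlCLM‖ * K * (K + ‖(1 / 2 : ℝ)‖ * 1 + ‖α‖ * 1) *
        (1 + ‖y‖) ^ (N + (N + (0 + 1) + (0 + 1))) := fun y =>
    le_mul_mul_pow_add (norm_smul_le _ _) (norm_nonneg _) (norm_nonneg _)
      (norm_curl_two_le_poly hD1 y) (hb y)
  have hg : ∀ y : EuclideanSpace ℝ (Fin 3), ‖gradient (fun w => curl U w 2) y‖ ≤ K * (1 + ‖y‖) ^ N :=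
    norm_gradient_curl_two_le_poly hωd hD2
  have hC : ∀ y : EuclideanSpace ℝ (Fin 3),
      ‖(U y 2) • curl U y‖ ≤ K * (‖curlCLM‖ * K) * (1 + ‖y‖) ^ (N + N) := fun y =>
    le_mul_mul_pow_add (norm_smul_le _ _) (norm_nonneg _) (norm_nonneg _)
      ((PiLp.norm_apply_le (U y) 2).trans (hUb y)) (norm_curl_le_poly hD1 y)
  refine ⟨‖curlCLM‖ * K * (K + ‖(1 / 2 : ℝ)‖ * 1 + ‖α‖ * 1) + K + K * (‖curlCLM‖ * K),
    N + (N + (0 + 1) + (0 + 1)) + N + (N + N), fun y => ?_⟩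
  exact (norm_sub_le _ _).trans (norm_add_norm_le_add_mul_pow (hR y)
    ((norm_sub_le _ _).trans (norm_add_norm_le_add_mul_pow (hR y) (hA y) (hg y))) (hC y))

end Summit.NavierStokesRegularity.NavierStokesRegularity.Theorems.CorkscrewProfile.Birth

end
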